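import Literature.AlgebraicGeometry.Motives.RatFnSpec
import HarnessLib

/-!
# Birational morphisms induce isomorphisms of function fields

For a dominant morphism `f : Z → Y` of integral schemes which is an isomorphism over a dense open
`U ⊆ Y` with `f⁻¹U` dense (e.g. a Chow cover, `Literature/AlgebraicGeometry/Resolution/ChowLemmaRing`),
the field map `f^♯ : K(Y) → K(Z)` (`RatFn.functionFieldMap`) is surjective, hence bijective
(`RatFn.functionFieldMap_surjective_of_isIso_morphismRestrict`): `K(Y) = K(U)`, `K(Z) = K(f⁻¹U)`
(open immersions, `functionFieldMap_bijective_of_isOpenImmersion` of `Motives/RatFnSpec`)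
and `f|_U : f⁻¹U ⥲ U` (Görtz–Wedhorn I, Prop. 3.29 and Def. 9.33: birational maps identify
function fields). Fully proved; no named facts.

## References

* U. Görtz, T. Wedhorn, *Algebraic Geometry I: Schemes*, 2nd ed. (2020): Prop. 3.29, Def. 9.33.
  [GortzWedhorn2020]
-/

universe u

open CategoryTheory AlgebraicGeometry TopologicalSpace

noncomputable section

namespace Literature.AlgebraicGeometry.Motives.RatFn

variable {Z Y : Scheme.{u}} [IsIntegral Z] [IsIntegral Y] (f : Z ⟶ Y) [IsDominant f]

/-- **A morphism which is an isomorphism over a dense open with dense preimage induces a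
surjection (hence a bijection) on function fields.** [cite: GortzWedhorn2020, Def. 9.33] -/
theorem functionFieldMap_surjective_of_isIso_morphismRestrict (U : Y.Opens)
    (hU : Dense ((U : Y.Opens) : Set Y)) (hU' : Dense ((f ⁻¹ᵁ U : Z.Opens) : Set Z))
    [IsIso (f ∣_ U)] : Function.Surjective (functionFieldMap f) := by
  haveI : IsDominant U.ι := Opens.isDominant_ι hU
  haveI : IsDominant (f ⁻¹ᵁ U).ι := Opens.isDominant_ι hU'
  haveI : Nonempty (f ⁻¹ᵁ U : Z.Opens) := by
    obtain ⟨z, hz⟩ := hU'.nonempty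
    exact ⟨⟨z, hz⟩⟩
  haveI : Nonempty (U : Y.Opens) := by
    obtain ⟨y, hy⟩ := hU.nonempty
    exact ⟨⟨y, hy⟩⟩
  haveI : IsDominant (f ∣_ U) := inferInstance
  -- `(f⁻¹U).ι ≫ f = f|_U ≫ U.ι` on function fields
  have hsq : (functionFieldMap (f ⁻¹ᵁ U).ι).comp (functionFieldMap f) =
      (functionFieldMap (f ∣_ U)).comp (functionFieldMap U.ι) := by
    rw [← functionFieldMap_comp, ← functionFieldMap_comp]
    congr 1
    exact (morphismRestrict_ι f U).symm
  intro z
  obtain ⟨y, hy⟩ := ((functionFieldMap_bijective_of_isOpenImmersion (f ∣_ U)).2.comp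
    (functionFieldMap_bijective_of_isOpenImmersion U.ι).2) (functionFieldMap (f ⁻¹ᵁ U).ι z)
  refine ⟨y, (functionFieldMap (f ⁻¹ᵁ U).ι).injective ?_⟩
  have := congrArg (fun φ => φ y) hsq
  simp only [RingHom.coe_comp, Function.comp_apply] at this
  rw [this]
  exact hy

/-- The bijective form. [folklore] -/
theorem functionFieldMap_bijective_of_isIso_morphismRestrict (U : Y.Opens)
    (hU : Dense ((U : Y.Opens) : Set Y)) (hU' : Dense ((f ⁻¹ᵁ U : Z.Opens) : Set Z))
    [IsIso (f ∣_ U)] : Function.Bijective (functionFieldMap f) :=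
  ⟨(functionFieldMap f).injective, functionFieldMap_surjective_of_isIso_morphismRestrict f U hU hU'⟩

end Literature.AlgebraicGeometry.Motives.RatFn

end
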